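import Summits.ValiantsHypothesis.ValiantsHypothesis.Theorems.DefinabilityGapBlockExclusion
import Summits.ValiantsHypothesis.ValiantsHypothesis.Theorems.DefinabilityGapUnitRigidityForms
import HarnessLib

/-!
# DefinabilityGap — THE BLOCK PERMANENT, stage H2: product formula, variables, KEY, primality

Route `route-ValiantsHypothesis-DefinabilityGap` (DRAFT), read-once leaf F4 / W10 (aside `KIPlantedHittingRO`,
stmt-ValiantsHypothesis-23704), leaf `ZperHits₂(m)`; census cell F4/W10 rung_ladder.next ‖ v35 «δ-parameter»
(decomp-valiant bus, OFFER O-L5-BK; file H2 of the series H1a / H1b / H2 / H3; H1a/H1b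
`DefinabilityGapAdmissibleBlocks` / `DefinabilityGapBlockExclusion` give the blocks `R_[a] = rowBlock T a`,
`C_[a] = colBlock T a` of a cell set `T` off which a permutation `σ₀` lives, and the gluing of avoiding maps).

**THIS FILE.** For `σ₀ ∈ avoid T` the BLOCK PERMANENT
`Q^[a] = blockPer F T a σ₀ = Σ_σ ∏_{i ∈ C_[a]} Y_(σ i, i)` over the `T`-avoiding `σ` that agree with `σ₀`
off `C_[a]` (= the permanent of the generic matrix of the block
`R_[a] × C_[a]` with zeros at `T`; it does not depend on `σ₀`), and the complementary `restPer`.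
* PRODUCT FORMULA `zpPer_eq_blockPer_mul_restPer`: `Q_T = Q^[a] · Q^[¬a]` (gluing is a bijection
  `avoid T ≃ {block part} × {rest part}`), so `Q^[a] ∣ Q_T`; and the EMBEDDING `zpPer_union_eq_blockPer_mul`:
  `Q_{T'} = Q^[a] · ∏_{i ∉ C_[a]} Y_(σ₀ i, i)` for `T' = T ∪ {off-block cells off σ₀}`;
* VARIABLES `mem_vars_blockPer_iff`: the variables of `Q^[a]` are exactly the admissible cells of the block rows;
  every monomial of `Q^[a]` meets all `|C_[a]| = |R_[a]|` block columns (`colBlock_subset_of_mem_support`);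
* KEY `eq_zero_of_mem_locSpan_of_blockPer_dvd` / `not_blockPer_dvd_topForm`: for `c < |R_[a]|` the `c`-local
  span meets the ideal `(Q^[a])` only in `0` (as E3's KEY for `Q_S`, with the block columns in place of all
  columns);
* **PRIMALITY** `blockPer_irreducible` / `blockPer_prime`: `Q^[a]` is irreducible — from E1's OWNERSHIP lemma
  `off_line_of_factor` applied to `Q_{T'} = A · (B · ∏ Y)`: a factorisation `Q^[a] = A · B` types every admissible
  cell of the block as an `A`-cell or a `B`-cell with no `B`-cell in the row or column of an `A`-cell, so the rows
  of `A`-cells are closed under ties; a block is one tie class, hence `B` has no variables.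

HONEST PLACEMENT. KNOWN mathematics: `Q^[a]` is the permanent of a fully indecomposable component of the
admissible pattern (Dulmage–Mendelsohn 1958; [cite: BrualdiRyser1991, Thm. 4.2.6/4.2.7]) and the generic matrix of
a fully indecomposable pattern has irreducible determinant AND permanent [cite: BrualdiRyser1991, Thm. 9.2.4 and
the remark following it]; the product formula is the block-triangular factorisation of the permanent. KERNEL-NEW
bookkeeping for the block census; closes NO item; 0 S-currency; rung 0; VP ≠ VNP untouched. No facts, no
Prop-valued definitions, no placeholders; data definitions `blockPer`, `restPer`.
-/

set_option linter.dupNamespace false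

open MvPolynomial Finset
open scoped Pointwise
open Literature.Computability.AlgebraicComplexity
open Summit.ValiantsHypothesis.ValiantsHypothesis.Theorems.DefinabilityGapUnitRigidityForms
open Summit.ValiantsHypothesis.ValiantsHypothesis.Theorems.DefinabilityGapZeroPatternPermanent
open Summit.ValiantsHypothesis.ValiantsHypothesis.Theorems.DefinabilityGapAdmissibleBlocks
open Summit.ValiantsHypothesis.ValiantsHypothesis.Theorems.DefinabilityGapBlockExclusion

namespace Summit.ValiantsHypothesis.ValiantsHypothesis.Theorems.DefinabilityGapBlockPermanent

noncomputable section

variable {m : ℕ}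

section BlockPermanent

variable (R : Type*) [CommSemiring R]

/-- The BLOCK PERMANENT `Q_T^[a]` of the block of `a`, relative to a base permutation `σ₀` (for
`σ₀ ∈ avoid T`: `Σ_π ∏_{i ∈ C_[a]} Y_(π i, i)` over the bijections `π : C_[a] → R_[a]` avoiding `T`).
[cite: BrualdiRyser1991, Thm. 4.2.7] -/
def blockPer (T : Finset (Fin m × Fin m)) (a : Fin m) (σ₀ : Equiv.Perm (Fin m)) :
    MvPolynomial (Fin m × Fin m) R :=
  ∑ σ ∈ (avoid T).filter (fun σ => ∀ i, i ∉ colBlock T a → σ i = σ₀ i), ∏ i ∈ colBlock T a, X (σ i, i)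

/-- The COMPLEMENTARY PERMANENT `Q_T^[¬a]` (all other blocks). [cite: BrualdiRyser1991, Thm. 4.2.7] -/
def restPer (T : Finset (Fin m × Fin m)) (a : Fin m) (σ₀ : Equiv.Perm (Fin m)) :
    MvPolynomial (Fin m × Fin m) R :=
  ∑ σ ∈ (avoid T).filter (fun σ => ∀ i ∈ colBlock T a, σ i = σ₀ i), ∏ i ∈ (colBlock T a)ᶜ, X (σ i, i)

variable {R}

/-- GLUING: `σ` on the column block of `a` and `τ` elsewhere is again a `T`-avoiding permutation. [folklore] -/
theorem exists_glue {T : Finset (Fin m × Fin m)} {σ τ : Equiv.Perm (Fin m)} (hσ : σ ∈ avoid T)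
    (hτ : τ ∈ avoid T) (a : Fin m) :
    ∃ γ ∈ avoid T, (∀ i ∈ colBlock T a, γ i = σ i) ∧ ∀ i, i ∉ colBlock T a → γ i = τ i := by
  obtain ⟨π, hπS, hπN⟩ := exists_gluePerm (S := colBlock T a) (Rr := rowBlock T a) (fun y => σ y)
    (fun y y' h => Subtype.ext (σ.injective h)) (fun y => apply_mem_rowBlock hσ y.2) τ
    (fun i => (mem_colBlock_iff_apply_mem_rowBlock hτ).symm)
  refine ⟨π, mem_avoid.2 fun i => ?_, fun i hi => hπS i hi, hπN⟩
  by_cases hi : i ∈ colBlock T a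
  · rw [hπS i hi]; exact mem_avoid.1 hσ i
  · rw [hπN i hi]; exact mem_avoid.1 hτ i

/-- PRODUCT FORMULA `Q_T = Q_T^[a] · Q_T^[¬a]`. [cite: BrualdiRyser1991, Thm. 4.2.7] -/
theorem zpPer_eq_blockPer_mul_restPer (T : Finset (Fin m × Fin m)) {σ₀ : Equiv.Perm (Fin m)}
    (hσ₀ : σ₀ ∈ avoid T) (a : Fin m) : zpPer R T = blockPer R T a σ₀ * restPer R T a σ₀ := by
  have hex : ∀ σ ∈ avoid T, ∀ τ ∈ avoid T, ∃ γ ∈ avoid T,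
      (∀ i ∈ colBlock T a, γ i = σ i) ∧ ∀ i, i ∉ colBlock T a → γ i = τ i :=
    fun σ hσ τ hτ => exists_glue hσ hτ a
  choose! g hg hgC hgN using hex
  rw [blockPer, restPer, sum_mul_sum, ← sum_product', zpPer]
  refine sum_nbij' (fun ρ => (g ρ σ₀, g σ₀ ρ)) (fun p => g p.1 p.2) (fun ρ hρ => ?_) (fun p hp => ?_)
    (fun ρ hρ => ?_) (fun p hp => ?_) (fun ρ hρ => ?_)
  · exact mem_product.2 ⟨mem_filter.2 ⟨hg ρ hρ σ₀ hσ₀, fun i hi => hgN ρ hρ σ₀ hσ₀ i hi⟩,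
      mem_filter.2 ⟨hg σ₀ hσ₀ ρ hρ, fun i hi => hgC σ₀ hσ₀ ρ hρ i hi⟩⟩
  · obtain ⟨h1, h2⟩ := mem_product.1 hp
    exact hg _ (mem_filter.1 h1).1 _ (mem_filter.1 h2).1
  · have h1 := hg ρ hρ σ₀ hσ₀
    have h2 := hg σ₀ hσ₀ ρ hρ
    refine Equiv.ext fun i => ?_
    show g (g ρ σ₀) (g σ₀ ρ) i = ρ i
    by_cases hi : i ∈ colBlock T a
    · rw [hgC _ h1 _ h2 i hi, hgC ρ hρ σ₀ hσ₀ i hi]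
    · rw [hgN _ h1 _ h2 i hi, hgN σ₀ hσ₀ ρ hρ i hi]
  · obtain ⟨h1, h2⟩ := mem_product.1 hp
    obtain ⟨hp1, hA1⟩ := mem_filter.1 h1
    obtain ⟨hp2, hB2⟩ := mem_filter.1 h2
    have h3 := hg _ hp1 _ hp2
    refine Prod.ext (Equiv.ext fun i => ?_) (Equiv.ext fun i => ?_)
    · show g (g p.1 p.2) σ₀ i = p.1 i
      by_cases hi : i ∈ colBlock T a
      · rw [hgC _ h3 σ₀ hσ₀ i hi, hgC _ hp1 _ hp2 i hi]
      · rw [hgN _ h3 σ₀ hσ₀ i hi, hA1 i hi]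
    · show g σ₀ (g p.1 p.2) i = p.2 i
      by_cases hi : i ∈ colBlock T a
      · rw [hgC σ₀ hσ₀ _ h3 i hi, hB2 i hi]
      · rw [hgN σ₀ hσ₀ _ h3 i hi, hgN _ hp1 _ hp2 i hi]
  · show ∏ i, X (ρ i, i) =
      (∏ i ∈ colBlock T a, X (g ρ σ₀ i, i)) * ∏ i ∈ (colBlock T a)ᶜ, X (g σ₀ ρ i, i)
    rw [← prod_mul_prod_compl (colBlock T a)]
    congr 1
    · exact prod_congr rfl fun i hi => by rw [hgC ρ hρ σ₀ hσ₀ i hi]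
    · exact prod_congr rfl fun i hi => by rw [hgN σ₀ hσ₀ ρ hρ i (mem_compl.1 hi)]

/-- `Q_T^[a] ∣ Q_T`. [cite: BrualdiRyser1991, Thm. 4.2.7] -/
theorem blockPer_dvd_zpPer (T : Finset (Fin m × Fin m)) {σ₀ : Equiv.Perm (Fin m)} (hσ₀ : σ₀ ∈ avoid T)
    (a : Fin m) : blockPer R T a σ₀ ∣ zpPer R T :=
  ⟨restPer R T a σ₀, zpPer_eq_blockPer_mul_restPer T hσ₀ a⟩

/-- `Q_{T'} = Q_T^[a] · ∏_{i ∉ C_[a]} Y_(σ₀ i, i)` for `T' = T ∪ {off-block cells off σ₀}` (the embedding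
used for ownership; `hσ₀` is unused — the identity holds for every `σ₀`). [this file] -/
theorem zpPer_union_eq_blockPer_mul (T : Finset (Fin m × Fin m)) {σ₀ : Equiv.Perm (Fin m)}
    (hσ₀ : σ₀ ∈ avoid T) (a : Fin m) :
    zpPer R (T ∪ univ.filter fun x => x.2 ∉ colBlock T a ∧ σ₀ x.2 ≠ x.1) =
      blockPer R T a σ₀ * ∏ i ∈ (colBlock T a)ᶜ, X (σ₀ i, i) := by
  have _ := hσ₀
  have hA : avoid (T ∪ univ.filter fun x => x.2 ∉ colBlock T a ∧ σ₀ x.2 ≠ x.1) =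
      (avoid T).filter fun σ => ∀ i, i ∉ colBlock T a → σ i = σ₀ i := by
    ext σ
    rw [mem_filter, mem_avoid, mem_avoid]
    constructor
    · intro h
      refine ⟨fun i hT => h i (mem_union_left _ hT), fun i hi => ?_⟩
      by_contra hne
      exact h i (mem_union_right _ (mem_filter.2 ⟨mem_univ _, hi, fun h' => hne h'.symm⟩))
    · rintro ⟨h1, h2⟩ i hi
      rcases mem_union.1 hi with hT | hF
      · exact h1 i hT
      · obtain ⟨-, hiC, hne⟩ := mem_filter.1 hF
        exact hne (h2 i hiC).symm
  rw [zpPer, hA, blockPer, sum_mul]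
  refine sum_congr rfl fun σ hσ => ?_
  rw [← prod_mul_prod_compl (colBlock T a) fun i => X (σ i, i)]
  congr 1
  exact prod_congr rfl fun i hi => by rw [(mem_filter.1 hσ).2 i (mem_compl.1 hi)]

/-- The exponent of the block monomial of `σ` at `(k, j)` is `[j ∈ C ∧ σ j = k]`. [this file] -/
theorem blockExp_apply (C : Finset (Fin m)) (σ : Equiv.Perm (Fin m)) (k j : Fin m) :
    (∑ i ∈ C, Finsupp.single (σ i, i) (1 : ℕ)) (k, j) = if j ∈ C ∧ σ j = k then 1 else 0 := by
  simp only [Finsupp.finsetSum_apply, Finsupp.single_apply, Prod.mk.injEq]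
  by_cases hj : j ∈ C
  · rw [Finset.sum_eq_single_of_mem j hj]
    · simp [hj]
    · intro i _ hij
      simp [hij]
  · rw [Finset.sum_eq_zero]
    · simp [hj]
    · intro i hi
      simp [ne_of_mem_of_not_mem hi hj]

/-- `Q_T^[a]` as a sum of monomials. [this file] -/
theorem blockPer_eq_sum_monomial (T : Finset (Fin m × Fin m)) (a : Fin m) (σ₀ : Equiv.Perm (Fin m)) :
    blockPer R T a σ₀ = ∑ σ ∈ (avoid T).filter (fun σ => ∀ i, i ∉ colBlock T a → σ i = σ₀ i),
      monomial (∑ i ∈ colBlock T a, Finsupp.single (σ i, i) 1) (1 : R) := by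
  refine sum_congr rfl fun σ _ => ?_
  rw [monomial_sum_one]
  rfl

/-- The coefficients of `Q_T^[a]`. [this file] -/
theorem coeff_blockPer (T : Finset (Fin m × Fin m)) (a : Fin m) (σ₀ : Equiv.Perm (Fin m))
    (d : (Fin m × Fin m) →₀ ℕ) : coeff d (blockPer R T a σ₀) =
      ∑ σ ∈ (avoid T).filter (fun σ => ∀ i, i ∉ colBlock T a → σ i = σ₀ i),
        if (∑ i ∈ colBlock T a, Finsupp.single (σ i, i) 1) = d then (1 : R) else 0 := by
  rw [blockPer_eq_sum_monomial, coeff_sum]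
  simp only [coeff_monomial]

/-- The support of `Q_T^[a]` consists of block monomials. [this file] -/
theorem exists_of_coeff_blockPer_ne_zero {T : Finset (Fin m × Fin m)} {a : Fin m} {σ₀ : Equiv.Perm (Fin m)}
    {d : (Fin m × Fin m) →₀ ℕ} (h : coeff d (blockPer R T a σ₀) ≠ 0) :
    ∃ σ ∈ (avoid T).filter (fun σ => ∀ i, i ∉ colBlock T a → σ i = σ₀ i),
      (∑ i ∈ colBlock T a, Finsupp.single (σ i, i) 1) = d := by
  rw [coeff_blockPer] at h
  obtain ⟨σ, hσ, hne⟩ := Finset.exists_ne_zero_of_sum_ne_zero h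
  exact ⟨σ, hσ, by by_contra h'; exact hne (if_neg h')⟩

/-- Every monomial of `Q_T^[a]` meets all the columns of `C_[a]`. [this file] -/
theorem colBlock_subset_of_mem_support {T : Finset (Fin m × Fin m)} {a : Fin m} {σ₀ : Equiv.Perm (Fin m)}
    {d : (Fin m × Fin m) →₀ ℕ} (hd : d ∈ (blockPer R T a σ₀).support) :
    colBlock T a ⊆ d.support.image Prod.snd := by
  obtain ⟨σ, -, rfl⟩ := exists_of_coeff_blockPer_ne_zero (mem_support_iff.1 hd)
  intro j hj
  refine mem_image.2 ⟨(σ j, j), Finsupp.mem_support_iff.2 ?_, rfl⟩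
  rw [blockExp_apply, if_pos (show j ∈ colBlock T a ∧ σ j = σ j from ⟨hj, rfl⟩)]
  exact one_ne_zero

/-- Block monomials separate the block parts. [this file] -/
theorem eq_of_blockExp_eq {T : Finset (Fin m × Fin m)} {a : Fin m} {σ₀ σ τ : Equiv.Perm (Fin m)}
    (hσ : σ ∈ (avoid T).filter (fun σ => ∀ i, i ∉ colBlock T a → σ i = σ₀ i))
    (hτ : τ ∈ (avoid T).filter (fun σ => ∀ i, i ∉ colBlock T a → σ i = σ₀ i))
    (h : (∑ i ∈ colBlock T a, Finsupp.single (σ i, i) (1 : ℕ)) =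
      ∑ i ∈ colBlock T a, Finsupp.single (τ i, i) 1) : σ = τ := by
  refine Equiv.ext fun j => ?_
  by_cases hj : j ∈ colBlock T a
  · have h1 := DFunLike.congr_fun h (σ j, j)
    rw [blockExp_apply, blockExp_apply, if_pos (show j ∈ colBlock T a ∧ σ j = σ j from ⟨hj, rfl⟩)] at h1
    by_contra hne
    rw [if_neg (show ¬(j ∈ colBlock T a ∧ τ j = σ j) from fun h' => hne h'.2.symm)] at h1
    exact one_ne_zero h1
  · rw [(mem_filter.1 hσ).2 j hj, (mem_filter.1 hτ).2 j hj]

/-- The block monomial of a block part `γ` has coefficient `1` in `Q_T^[a]`. [this file] -/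
theorem coeff_blockExp_blockPer {T : Finset (Fin m × Fin m)} {a : Fin m} {σ₀ γ : Equiv.Perm (Fin m)}
    (hγ : γ ∈ (avoid T).filter (fun σ => ∀ i, i ∉ colBlock T a → σ i = σ₀ i)) :
    coeff (∑ i ∈ colBlock T a, Finsupp.single (γ i, i) 1) (blockPer R T a σ₀) = 1 := by
  rw [coeff_blockPer, Finset.sum_eq_single_of_mem γ hγ]
  · exact if_pos rfl
  · intro σ hσ hne
    exact if_neg fun h => hne (eq_of_blockExp_eq hσ hγ h)

variable {F : Type*} [Field F]

/-- The variables of `Q_T^[a]` are the admissible cells of the block rows. [this file] -/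
theorem mem_vars_blockPer_iff {T : Finset (Fin m × Fin m)} {σ₀ : Equiv.Perm (Fin m)} (hσ₀ : σ₀ ∈ avoid T)
    {a : Fin m} {x : Fin m × Fin m} : x ∈ (blockPer F T a σ₀).vars ↔ x ∈ adm T ∧ x.1 ∈ rowBlock T a := by
  obtain ⟨k, j⟩ := x
  rw [mem_vars_iff_mem_support]
  constructor
  · rintro ⟨d, hd, hx⟩
    obtain ⟨σ, hσA, rfl⟩ := exists_of_coeff_blockPer_ne_zero (mem_support_iff.1 hd)
    have hσ : σ ∈ avoid T := (mem_filter.1 hσA).1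
    rw [Finsupp.mem_support_iff, blockExp_apply] at hx
    have hjk : j ∈ colBlock T a ∧ σ j = k := by by_contra h'; exact hx (if_neg h')
    refine ⟨mk_mem_adm.2 ⟨σ, hσ, hjk.2⟩, ?_⟩
    rw [← hjk.2]
    exact apply_mem_rowBlock hσ hjk.1
  · rintro ⟨hadm, hk⟩
    obtain ⟨ρ, hρ, hρj⟩ := mk_mem_adm.1 hadm
    have hj : j ∈ colBlock T a := snd_mem_colBlock hadm hk
    obtain ⟨γ, hγ, hγC, hγN⟩ := exists_glue hρ hσ₀ a
    have hγA : γ ∈ (avoid T).filter (fun σ => ∀ i, i ∉ colBlock T a → σ i = σ₀ i) :=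
      mem_filter.2 ⟨hγ, hγN⟩
    refine ⟨∑ i ∈ colBlock T a, Finsupp.single (γ i, i) 1, mem_support_iff.2 ?_,
      Finsupp.mem_support_iff.2 ?_⟩
    · rw [coeff_blockExp_blockPer hγA]; exact one_ne_zero
    · rw [blockExp_apply, if_pos (show j ∈ colBlock T a ∧ γ j = k from ⟨hj, (hγC j hj).trans hρj⟩)]
      exact one_ne_zero

/-- `Q_T^[a] ≠ 0` (the block monomial of `σ₀` has coefficient `1`). [this file] -/
theorem blockPer_ne_zero {T : Finset (Fin m × Fin m)} {σ₀ : Equiv.Perm (Fin m)} (hσ₀ : σ₀ ∈ avoid T)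
    (a : Fin m) : blockPer F T a σ₀ ≠ 0 := fun h => by
  have h1 := coeff_blockExp_blockPer (R := F) (a := a)
    (mem_filter.2 ⟨hσ₀, fun i _ => rfl⟩ :
      σ₀ ∈ (avoid T).filter (fun σ => ∀ i, i ∉ colBlock T a → σ i = σ₀ i))
  rw [h, coeff_zero] at h1
  exact zero_ne_one h1

/-- KEY for the block permanent: a `c`-local polynomial divisible by `Q_T^[a]`, `|R_[a]| > c`, vanishes.
[this file] -/
theorem eq_zero_of_mem_locSpan_of_blockPer_dvd {c : ℕ} {T : Finset (Fin m × Fin m)}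
    {σ₀ : Equiv.Perm (Fin m)} (hσ₀ : σ₀ ∈ avoid T) {a : Fin m} (hc : c < (rowBlock T a).card)
    {f : MvPolynomial (Fin m × Fin m) F} (hf : f ∈ locSpan F (Fin m × Fin m) c)
    (h : blockPer F T a σ₀ ∣ f) : f = 0 := by
  classical
  obtain ⟨H, rfl⟩ := h
  by_contra hne
  obtain ⟨d, hd⟩ := support_nonempty.2 hne
  have hcd := (mem_locSpan.1 hf) d hd
  obtain ⟨e, he, b, -, rfl⟩ := Finset.mem_add.1 (support_mul _ _ hd)
  have hm : (rowBlock T a).card ≤ (e + b).support.card := by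
    calc (rowBlock T a).card = (colBlock T a).card := (card_colBlock ⟨σ₀, hσ₀⟩ a).symm
      _ ≤ (e.support.image Prod.snd).card := card_le_card (colBlock_subset_of_mem_support he)
      _ ≤ e.support.card := card_image_le
      _ ≤ (e + b).support.card := card_le_card fun v hv => by
          rw [Finsupp.mem_support_iff] at hv ⊢
          rw [Finsupp.add_apply]; omega
  omega

/-- Hence `Q_T^[a]` divides the top form of no non-zero `c`-local polynomial, `c < |R_[a]|`. [this file] -/
theorem not_blockPer_dvd_topForm {c : ℕ} {T : Finset (Fin m × Fin m)} {σ₀ : Equiv.Perm (Fin m)}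
    (hσ₀ : σ₀ ∈ avoid T) {a : Fin m} (hc : c < (rowBlock T a).card) {f : MvPolynomial (Fin m × Fin m) F}
    (hf : f ∈ locSpan F (Fin m × Fin m) c) (h0 : f ≠ 0) : ¬ blockPer F T a σ₀ ∣ topForm f :=
  fun hd => topForm_ne_zero h0 (eq_zero_of_mem_locSpan_of_blockPer_dvd hσ₀ hc (topForm_mem_locSpan hf) hd)

/-- **THE BLOCK PERMANENT IS IRREDUCIBLE** (ownership `off_line_of_factor` on `Q_{T'}` splits the block rows
into `A`-rows and `B`-rows with no tie across; the block is one class of the closure of the ties).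
[cite: BrualdiRyser1991, Thm. 9.2.4] -/
theorem blockPer_irreducible {T : Finset (Fin m × Fin m)} {σ₀ : Equiv.Perm (Fin m)} (hσ₀ : σ₀ ∈ avoid T)
    (a : Fin m) : Irreducible (blockPer F T a σ₀) := by
  classical
  have hQ0 := blockPer_ne_zero (F := F) hσ₀ a
  have hvars : ∀ {x : Fin m × Fin m}, x ∈ (blockPer F T a σ₀).vars ↔ x ∈ adm T ∧ x.1 ∈ rowBlock T a :=
    mem_vars_blockPer_iff hσ₀
  have hxv : (a, σ₀.symm a) ∈ (blockPer F T a σ₀).vars :=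
    hvars.2 ⟨by simpa using apply_mem_adm hσ₀ (σ₀.symm a), self_mem_rowBlock T a⟩
  refine ⟨fun hu => ?_, fun A B hAB => ?_⟩
  · obtain ⟨r, -, hr⟩ := isUnit_iff_eq_C_of_isReduced.mp hu
    rw [hr, vars_C] at hxv
    exact Finset.notMem_empty _ hxv
  have h0 : A * B ≠ 0 := hAB ▸ hQ0
  have hA0 := left_ne_zero_of_mul h0
  have hB0 := right_ne_zero_of_mul h0
  by_cases hA : A.vars = ∅
  · exact Or.inl (isUnit_of_vars_eq_empty hA0 hA)
  by_cases hB : B.vars = ∅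
  · exact Or.inr (isUnit_of_vars_eq_empty hB0 hB)
  exfalso
  obtain ⟨x₀, hx₀⟩ := Finset.nonempty_iff_ne_empty.2 hA
  obtain ⟨y₀, hy₀⟩ := Finset.nonempty_iff_ne_empty.2 hB
  -- variables of the factors are variables of `Q^[a]` (degrees add on products over a domain)
  have hsub : ∀ {P Q : MvPolynomial (Fin m × Fin m) F}, P ≠ 0 → Q ≠ 0 → P.vars ⊆ (P * Q).vars :=
    fun hP hQ v hv => by
      rw [mem_vars_iff_degreeOf_ne_zero] at hv ⊢
      rw [degreeOf_mul_eq hP hQ]; omega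
  have hAQ : A.vars ⊆ (blockPer F T a σ₀).vars := by rw [hAB]; exact hsub hA0 hB0
  have hBQ : B.vars ⊆ (blockPer F T a σ₀).vars := fun v hv => by
    rw [hAB, mul_comm]; exact hsub hB0 hA0 hv
  -- the embedding `Q_{T'} = A · (B · ∏_{i ∉ C_[a]} Y_(σ₀ i, i))` and OWNERSHIP
  have hM0 : (∏ i ∈ (colBlock T a)ᶜ, X (σ₀ i, i) : MvPolynomial (Fin m × Fin m) F) ≠ 0 :=
    prod_ne_zero_iff.2 fun i _ => X_ne_zero _
  have hT' : zpPer F (T ∪ univ.filter fun x => x.2 ∉ colBlock T a ∧ σ₀ x.2 ≠ x.1) =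
      A * (B * ∏ i ∈ (colBlock T a)ᶜ, X (σ₀ i, i)) := by
    rw [zpPer_union_eq_blockPer_mul T hσ₀ a, hAB, mul_assoc]
  have hBM : B.vars ⊆ (B * ∏ i ∈ (colBlock T a)ᶜ, X (σ₀ i, i)).vars := hsub hB0 hM0
  have own : ∀ {x y : Fin m × Fin m}, x ∈ A.vars → y ∈ B.vars → y.1 ≠ x.1 ∧ y.2 ≠ x.2 :=
    fun hx hy => off_line_of_factor hT' hx (hBM hy)
  -- every admissible cell of the block is an `A`-cell or a `B`-cell
  have typ : ∀ {x : Fin m × Fin m}, x ∈ adm T → x.1 ∈ rowBlock T a → x ∈ A.vars ∨ x ∈ B.vars :=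
    fun hx hR => mem_union.1 (vars_mul A B (hAB ▸ hvars.2 ⟨hx, hR⟩))
  -- the rows of the `A`-cells (plus the foreign rows) are closed under ties
  have hcl : ∀ k k', (k, k') ∈ ties T → k ∈ A.vars.image Prod.fst ∪ (rowBlock T a)ᶜ →
      k' ∈ A.vars.image Prod.fst ∪ (rowBlock T a)ᶜ := by
    intro k k' hkk' hk
    rcases mem_union.1 hk with hk | hk
    · obtain ⟨x, hx, rfl⟩ := mem_image.1 hk
      obtain ⟨b, hxb, hk'b⟩ := mem_ties.1 hkk'
      have hxR : x.1 ∈ rowBlock T a := (hvars.1 (hAQ hx)).2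
      have hk'R : k' ∈ rowBlock T a := by
        rw [← rowBlock_eq_of_mem hxR]; exact mem_rowBlock_of_mem_ties hkk'
      have hv1 : (x.1, b) ∈ A.vars :=
        (typ hxb hxR).resolve_right fun h => (own hx h).1 rfl
      have hv2 : (k', b) ∈ A.vars :=
        (typ hk'b hk'R).resolve_right fun h => (own hv1 h).2 rfl
      exact mem_union_left _ (mem_image.2 ⟨(k', b), hv2, rfl⟩)
    · refine mem_union_right _ (mem_compl.2 fun hk' => mem_compl.1 hk ?_)
      rw [← rowBlock_eq_of_mem hk', mem_rowBlock_comm]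
      exact mem_rowBlock_of_mem_ties hkk'
  -- hence the whole block consists of `A`-rows, contradicting the `B`-cell `y₀`
  have hx₀R : x₀.1 ∈ rowBlock T a := (hvars.1 (hAQ hx₀)).2
  have hy₀R : y₀.1 ∈ rowBlock T a := (hvars.1 (hBQ hy₀)).2
  have hX := rowBlock_subset_of_closed (T := T) (mem_union_left _ (mem_image_of_mem Prod.fst hx₀)) hcl
  rw [rowBlock_eq_of_mem hx₀R] at hX
  rcases mem_union.1 (hX hy₀R) with h | h
  · obtain ⟨x, hx, hxy⟩ := mem_image.1 h
    exact (own hx hy₀).1 hxy.symm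
  · exact mem_compl.1 h hy₀R

/-- Hence `Q_T^[a]` is PRIME (`F[Y]` is factorial). [cite: BrualdiRyser1991, Thm. 9.2.4] -/
theorem blockPer_prime {T : Finset (Fin m × Fin m)} {σ₀ : Equiv.Perm (Fin m)} (hσ₀ : σ₀ ∈ avoid T)
    (a : Fin m) : Prime (blockPer F T a σ₀) :=
  UniqueFactorizationMonoid.irreducible_iff_prime.mp (blockPer_irreducible hσ₀ a)

end BlockPermanent

end

end Summit.ValiantsHypothesis.ValiantsHypothesis.Theorems.DefinabilityGapBlockPermanent
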